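import Summits.RiemannHypothesis.RiemannHypothesis.Theorems.JensenLogBandArcSaddleDen
import HarnessLib

/-!
# The denominator `D(u)` on the right half-annulus (BAND line, groundwork for step S4c)

RH ladder column JENSEN, rung J-P(P3) «log band», BAND crux `XiDerivBandRealAllRates` of route
«JensenLogBand», line «band-one-window» (u-arc reshape), lead rh-jensen-prover g7 — groundwork for
step (S4c) «global descent along the arc» of HOME/rh-jensen-prover/g7-work/LINE-PLAN.md §7/§8.
RH-FREE (Γ-factor only). WHAT THIS IS NOT: nothing here bears on zeros of `ζ` or the truth of RH.

The whole right half-arc `u = c + r e^{iφ}`, `|φ| ≤ π/2`, `r = |u* − c| ≤ (10/9)·h` is NOT inside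
the disc `|u − (c+h)| ≤ (3/5)h` of `JensenLogBandArcSaddleDen.lean`; the descent estimate needs
the bounds for `D(u) = λ′(½+u) + 1/u − (n+1)/(u+c)` on the right half-annulus
`Re(u − c) ≥ 0`, `|u − c| ≤ (6/5)h`. Here: its geometry (`halfAnnulus_geometry`: `Im(½+u) ≥ 0.58T`,
`Re(½+u) ≥ 0`, …) and `saddleDen_re_im_bounds_halfAnnulus`:
`(11/25)ℓ ≤ Re D ≤ (57/100)ℓ`, `−1/8 ≤ Im D ≤ 1 + ℓ/9` (same proof as on the disc, weaker constants).
With eng-2 g5's `hasDerivAt_log_norm_arcModelIntegrand` (p487066: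
`d/dφ log‖arcModelIntegrand‖ = Re(i(u−c)·S_{n,c}(u))`) and `S = D − n/(u−c)` this gives
`d/dφ log‖arcModelIntegrand n r c φ‖ = −r(sin φ · Re D + cos φ · Im D)`
(`re_I_mul_sub_mul_arcSaddleFn`): strictly negative for `φ ≥ 1/50` and strictly positive for
`φ ≤ −2/5` — monotone flanks of the arc (`descent_deriv_neg_of_angle_ge`, `ascent_deriv_pos_of_angle_le`).
-/

noncomputable section

-- single-problem summit: `Summit.RiemannHypothesis.RiemannHypothesis.…` is the tree convention
set_option linter.dupNamespace false

open Complex Real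

namespace Summit.RiemannHypothesis.RiemannHypothesis.Theorems.JensenPolynomials.LogBandArc

open Literature.NumberTheory.LFunctions

section halfAnnulus

variable {n : ℕ} {x T h : ℝ} {u : ℂ}

/-- **Geometry of the right half-annulus** `Re(u − c) ≥ 0`, `|u − c| ≤ (6/5)h` (`c = x + iT`,
`|x| ≤ ½`, `T ≥ 100`, `½ ≤ h ≤ (7/20)T`), `s = ½ + u`: `0.58T ≤ Im s ≤ T + (6/5)h`,
`0 ≤ Re s ≤ 1 + (6/5)h`, `0.58T ≤ ‖s‖ ≤ 1.85T`, `‖u‖ ≥ 0.58T`, `Im(u+c) ≥ 1.58T`,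
`|Re(u+c)| ≤ 1 + (6/5)h`, `‖u+c‖ ≥ 1.58T`. [folklore] -/
theorem halfAnnulus_geometry (hx : |x| ≤ 1 / 2) (hT : 100 ≤ T) (hh : 1 / 2 ≤ h)
    (hhT : h ≤ 7 / 20 * T) (hure : 0 ≤ (u - ((x : ℂ) + (T : ℂ) * I)).re)
    (hur : ‖u - ((x : ℂ) + (T : ℂ) * I)‖ ≤ 6 / 5 * h) :
    29 / 50 * T ≤ (1 / 2 + u).im ∧ (1 / 2 + u).im ≤ T + 6 / 5 * h ∧
    0 ≤ (1 / 2 + u).re ∧ (1 / 2 + u).re ≤ 1 + 6 / 5 * h ∧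
    29 / 50 * T ≤ ‖1 / 2 + u‖ ∧ ‖1 / 2 + u‖ ≤ 37 / 20 * T ∧
    29 / 50 * T ≤ ‖u‖ ∧ 79 / 50 * T ≤ (u + ((x : ℂ) + (T : ℂ) * I)).im ∧
    |(u + ((x : ℂ) + (T : ℂ) * I)).re| ≤ 1 + 6 / 5 * h ∧
    79 / 50 * T ≤ ‖u + ((x : ℂ) + (T : ℂ) * I)‖ := by
  have him : |(u - ((x : ℂ) + (T : ℂ) * I)).im| ≤ 6 / 5 * h :=
    (Complex.abs_im_le_norm _).trans hur
  have hre : |(u - ((x : ℂ) + (T : ℂ) * I)).re| ≤ 6 / 5 * h :=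
    (Complex.abs_re_le_norm _).trans hur
  simp at him hre hure
  have hx' := abs_le.1 hx
  have him' := abs_le.1 him
  have hre' := abs_le.1 hre
  have hsim : (1 / 2 + u).im = u.im := by simp
  have hsre : (1 / 2 + u).re = 1 / 2 + u.re := by simp
  have h1 : 29 / 50 * T ≤ (1 / 2 + u).im := by rw [hsim]; linarith
  have h2 : (1 / 2 + u).im ≤ T + 6 / 5 * h := by rw [hsim]; linarith
  have h3 : 0 ≤ (1 / 2 + u).re := by rw [hsre]; linarith
  have h4 : (1 / 2 + u).re ≤ 1 + 6 / 5 * h := by rw [hsre]; linarith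
  have h5 : 29 / 50 * T ≤ ‖1 / 2 + u‖ :=
    h1.trans ((le_abs_self _).trans (Complex.abs_im_le_norm _))
  have h6 : ‖1 / 2 + u‖ ≤ 37 / 20 * T := by
    have := Complex.norm_le_abs_re_add_abs_im (1 / 2 + u)
    rw [abs_of_nonneg h3, abs_of_nonneg (by linarith : 0 ≤ (1 / 2 + u).im)] at this
    linarith
  have h7 : 29 / 50 * T ≤ ‖u‖ := by
    have : 29 / 50 * T ≤ u.im := by linarith
    exact this.trans ((le_abs_self _).trans (Complex.abs_im_le_norm _))
  have hucim : (u + ((x : ℂ) + (T : ℂ) * I)).im = u.im + T := by simp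
  have hucre : (u + ((x : ℂ) + (T : ℂ) * I)).re = u.re + x := by simp
  have h8 : 79 / 50 * T ≤ (u + ((x : ℂ) + (T : ℂ) * I)).im := by rw [hucim]; linarith
  have h9 : |(u + ((x : ℂ) + (T : ℂ) * I)).re| ≤ 1 + 6 / 5 * h := by
    rw [hucre, abs_le]; constructor <;> linarith
  have h10 : 79 / 50 * T ≤ ‖u + ((x : ℂ) + (T : ℂ) * I)‖ :=
    h8.trans ((le_abs_self _).trans (Complex.abs_im_le_norm _))
  exact ⟨h1, h2, h3, h4, h5, h6, h7, h8, h9, h10⟩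

/-- **Bounds for `D(u)` on the right half-annulus:** `(11/25)ℓ ≤ Re D ≤ (57/100)ℓ`,
`−1/8 ≤ Im D ≤ 1 + ℓ/9`. [folklore] -/
theorem saddleDen_re_im_bounds_halfAnnulus (hx : |x| ≤ 1 / 2) (hT : 100 ≤ T) (hℓ : 20 ≤ ell T)
    (hh : 1 / 2 ≤ bandRadius n T) (hhT : bandRadius n T ≤ 7 / 20 * T)
    (hure : 0 ≤ (u - ((x : ℂ) + (T : ℂ) * I)).re)
    (hur : ‖u - ((x : ℂ) + (T : ℂ) * I)‖ ≤ 6 / 5 * bandRadius n T) :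
    11 / 25 * ell T ≤ (saddleDen n ((x : ℂ) + (T : ℂ) * I) u).re ∧
    (saddleDen n ((x : ℂ) + (T : ℂ) * I) u).re ≤ 57 / 100 * ell T ∧
    -(1 / 8) ≤ (saddleDen n ((x : ℂ) + (T : ℂ) * I) u).im ∧
    (saddleDen n ((x : ℂ) + (T : ℂ) * I) u).im ≤ 1 + ell T / 9 := by
  set h := bandRadius n T with hhdef
  set ℓ := ell T with hℓdef
  set c : ℂ := (x : ℂ) + (T : ℂ) * I with hc
  set s : ℂ := 1 / 2 + u with hs
  obtain ⟨him_lo, him_hi, hre_lo, hre_hi, hns_lo, hns_hi, hnu_lo, hucim, hucre, hnuc⟩ :=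
    halfAnnulus_geometry hx hT hh hhT hure hur
  rw [← hc] at hucim hucre hnuc
  rw [← hs] at him_lo him_hi hre_lo hre_hi hns_lo hns_hi
  have hT0 : 0 < T := by linarith
  have hhℓ : h * ℓ = 2 * ((n : ℝ) + 1) := bandRadius_mul_ell hℓ
  have hτ : h / T ≤ 7 / 20 := by rw [div_le_iff₀ hT0]; linarith
  have hs0 : s ≠ 0 := by
    intro h0
    rw [h0, norm_zero] at hns_lo
    linarith
  have him0 : 0 < s.im := him_lo.trans_lt' (by linarith)
  -- Stirling error
  have hE : ‖lamPrime s - Complex.log (s / (2 * Real.pi)) / 2‖ ≤ 6 / s.im := by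
    unfold lamPrime
    exact norm_xiGammaLogDeriv_sub_half_log_le_of_re_nonneg (by linarith) (by linarith)
  have hE' : ‖lamPrime s - Complex.log (s / (2 * Real.pi)) / 2‖ ≤ 21 / 200 := by
    refine hE.trans ?_
    rw [div_le_div_iff₀ him0 (by norm_num)]
    linarith
  set E := lamPrime s - Complex.log (s / (2 * Real.pi)) / 2 with hEdef
  have hEre : |E.re| ≤ 21 / 200 := (Complex.abs_re_le_norm E).trans hE'
  have hEim : |E.im| ≤ 21 / 200 := (Complex.abs_im_le_norm E).trans hE'
  -- the main term
  obtain ⟨hLre, hLim0, hLim1⟩ := half_log_div_two_pi_re_im hs0 (by linarith) him0.le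
  have hlogT : Real.log (2 * Real.pi) = Real.log T - ℓ := by
    rw [hℓdef, ell, Real.log_div hT0.ne' (by positivity)]; ring
  -- `(log ‖s‖ − log T)/2 ∈ [−0.365, 0.425]`
  have hlog_lo : -(73 / 100) ≤ Real.log ‖s‖ - Real.log T := by
    have h1 : Real.log (29 / 50 * T) ≤ Real.log ‖s‖ := Real.log_le_log (by positivity) hns_lo
    rw [Real.log_mul (by norm_num) hT0.ne'] at h1
    have h2 : -(73 / 100) ≤ Real.log (29 / 50 : ℝ) := by
      have := Real.log_le_sub_one_of_pos (show (0:ℝ) < 50 / 29 by norm_num)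
      rw [show (50 / 29 : ℝ) = (29 / 50)⁻¹ by norm_num, Real.log_inv] at this
      linarith
    linarith
  have hlog_hi : Real.log ‖s‖ - Real.log T ≤ 85 / 100 := by
    have h1 : Real.log ‖s‖ ≤ Real.log (37 / 20 * T) :=
      Real.log_le_log (by linarith) hns_hi
    rw [Real.log_mul (by norm_num) hT0.ne'] at h1
    have h2 : Real.log (37 / 20 : ℝ) ≤ 85 / 100 := by
      have := Real.log_le_sub_one_of_pos (show (0:ℝ) < 37 / 20 by norm_num)
      linarith
    linarith
  -- `1/u`
  have hinvu : ‖1 / u‖ ≤ 1 / 58 := by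
    rw [norm_div, norm_one]
    exact (div_le_div_iff₀ (by linarith) (by norm_num)).2 (by linarith)
  have hinvu_re : |(1 / u).re| ≤ 1 / 58 := (Complex.abs_re_le_norm _).trans hinvu
  have hinvu_im : |(1 / u).im| ≤ 1 / 58 := (Complex.abs_im_le_norm _).trans hinvu
  -- `(n+1)/(u+c)`
  have hnsq : (79 / 50 * T) ^ 2 ≤ Complex.normSq (u + c) := by
    rw [Complex.normSq_eq_norm_sq]
    exact pow_le_pow_left₀ (by positivity) hnuc 2
  have hnsq_pos : 0 < Complex.normSq (u + c) := lt_of_lt_of_le (by positivity) hnsq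
  have hnre : ((n : ℂ) + 1).re = (n : ℝ) + 1 := by simp
  have hnim : ((n : ℂ) + 1).im = 0 := by simp
  have hQre : (((n : ℂ) + 1) / (u + c)).re = ((n : ℝ) + 1) * (u + c).re / Complex.normSq (u + c) := by
    rw [Complex.div_re, hnre, hnim, zero_mul, zero_div, add_zero]
  have hQim : (((n : ℂ) + 1) / (u + c)).im = -(((n : ℝ) + 1) * (u + c).im) / Complex.normSq (u + c) := by
    rw [Complex.div_im, hnre, hnim, zero_mul, zero_div, zero_sub, neg_div]
  have hn1 : (0 : ℝ) < (n : ℝ) + 1 := by positivity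
  -- |Re Q| ≤ (n+1)(1 + 8h/5)/(1.79 T)²  ≤ 0.0311 ℓ
  have hQre_bd : |(((n : ℂ) + 1) / (u + c)).re| ≤ 31 / 1000 * ℓ := by
    rw [hQre, abs_div, abs_of_pos hnsq_pos, div_le_iff₀ hnsq_pos, abs_mul, abs_of_pos hn1]
    have hA : ((n : ℝ) + 1) * |(u + c).re| ≤ ((n : ℝ) + 1) * (1 + 6 / 5 * h) :=
      mul_le_mul_of_nonneg_left hucre hn1.le
    refine hA.trans ?_
    -- (n+1)(1 + 6h/5) ≤ 0.031 ℓ (1.58T)² ≤ 0.031 ℓ normSq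
    have hℓ0 : 0 < ℓ := by linarith
    have hh2 : h ^ 2 ≤ 49 / 400 * T ^ 2 := by
      have := pow_le_pow_left₀ (by linarith : (0 : ℝ) ≤ h) hhT 2
      rw [mul_pow] at this
      norm_num at this
      linarith
    have hT2 : 7 / 20 * T ≤ 7 / 2000 * T ^ 2 := by
      have := mul_le_mul_of_nonneg_left hT (by linarith : 0 ≤ 7 / 2000 * T)
      have e2 : (7 : ℝ) / 2000 * T * 100 = 7 / 20 * T := by ring
      have e3 : (7 : ℝ) / 2000 * T * T = 7 / 2000 * T ^ 2 := by ring
      linarith only [this, e2, e3]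
    have h1 : h * (1 + 6 / 5 * h) ≤ 1547768 / 10000000 * T ^ 2 := by
      have e : h * (1 + 6 / 5 * h) = h + 6 / 5 * h ^ 2 := by ring
      have h3 : h ≤ 7 / 2000 * T ^ 2 := hhT.trans hT2
      have hT2nn : 0 ≤ T ^ 2 := sq_nonneg T
      rw [e]
      linarith only [hh2, h3, hT2nn]
    have hkey : ((n : ℝ) + 1) * (1 + 6 / 5 * h) ≤ 31 / 1000 * ℓ * (79 / 50 * T) ^ 2 := by
      have e : ((n : ℝ) + 1) = h * ℓ / 2 := by linarith only [hhℓ]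
      have := mul_le_mul_of_nonneg_left h1 (by linarith only [hℓ0] : 0 ≤ ℓ / 2)
      calc ((n : ℝ) + 1) * (1 + 6 / 5 * h) = ℓ / 2 * (h * (1 + 6 / 5 * h)) := by rw [e]; ring
        _ ≤ ℓ / 2 * (1547768 / 10000000 * T ^ 2) := this
        _ = 31 / 1000 * ℓ * (79 / 50 * T) ^ 2 := by ring
    exact hkey.trans (mul_le_mul_of_nonneg_left hnsq (by linarith only [hℓ]))
  -- 0 ≤ −Im Q ≤ 0.1108 ℓ
  have hQim_nonpos : (((n : ℂ) + 1) / (u + c)).im ≤ 0 := by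
    rw [hQim, div_le_iff₀ hnsq_pos, zero_mul, neg_le, neg_zero]
    exact mul_nonneg hn1.le (by linarith only [hucim, hT0])
  have hQim_bd : -(((n : ℂ) + 1) / (u + c)).im ≤ 1108 / 10000 * ℓ := by
    rw [hQim, neg_div, neg_neg, div_le_iff₀ hnsq_pos]
    -- (n+1) Im(u+c) ≤ 0.0978 ℓ normSq; use normSq ≥ Im(u+c)² and (n+1) ≤ 0.0978 ℓ Im(u+c)
    have hIm0 : 0 < (u + c).im := by linarith only [hucim, hT0]
    have hsq : (u + c).im ^ 2 ≤ Complex.normSq (u + c) := by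
      rw [Complex.normSq_apply, sq]
      have := mul_self_nonneg (u + c).re
      linarith only [this]
    have h1 : ((n : ℝ) + 1) ≤ 1108 / 10000 * ℓ * (u + c).im := by
      have e : ((n : ℝ) + 1) = ℓ * (h / 2) := by linarith only [hhℓ]
      have hℓ0 : 0 < ℓ := by linarith only [hℓ]
      have h2 : h / 2 ≤ 1108 / 10000 * (u + c).im := by linarith only [hhT, hucim, hT0]
      calc ((n : ℝ) + 1) = ℓ * (h / 2) := e
        _ ≤ ℓ * (1108 / 10000 * (u + c).im) := mul_le_mul_of_nonneg_left h2 hℓ0.le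
        _ = 1108 / 10000 * ℓ * (u + c).im := by ring
    calc ((n : ℝ) + 1) * (u + c).im ≤ 1108 / 10000 * ℓ * (u + c).im * (u + c).im :=
          mul_le_mul_of_nonneg_right h1 hIm0.le
      _ = 1108 / 10000 * ℓ * (u + c).im ^ 2 := by ring
      _ ≤ 1108 / 10000 * ℓ * Complex.normSq (u + c) :=
          mul_le_mul_of_nonneg_left hsq (by linarith only [hℓ])
  -- assemble: Den = (Log/2 + E) + 1/u − Q
  have hDen : saddleDen n c u = (Complex.log (s / (2 * Real.pi)) / 2 + E) + 1 / u -
      ((n : ℂ) + 1) / (u + c) := by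
    rw [saddleDen, hEdef]; ring
  have hDre : (saddleDen n c u).re = (Real.log ‖s‖ - Real.log (2 * Real.pi)) / 2 + E.re +
      (1 / u).re - (((n : ℂ) + 1) / (u + c)).re := by
    rw [hDen]; simp [hLre]
  have hDim : (saddleDen n c u).im = (Complex.log (s / (2 * Real.pi)) / 2).im + E.im +
      (1 / u).im - (((n : ℂ) + 1) / (u + c)).im := by
    rw [hDen]; simp
  have hEre' := abs_le.1 hEre
  have hEim' := abs_le.1 hEim
  have hinvu_re' := abs_le.1 hinvu_re
  have hinvu_im' := abs_le.1 hinvu_im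
  have hQre' := abs_le.1 hQre_bd
  refine ⟨?_, ?_, ?_, ?_⟩
  · rw [hDre, hlogT]
    linarith only [hlog_lo, hEre'.1, hinvu_re'.1, hQre'.2, hℓ]
  · rw [hDre, hlogT]
    linarith only [hlog_hi, hEre'.2, hinvu_re'.2, hQre'.1, hℓ]
  · rw [hDim]
    linarith only [hLim0, hEim'.1, hinvu_im'.1, hQim_nonpos]
  · rw [hDim]
    linarith only [hLim1, hEim'.2, hinvu_im'.2, hQim_bd, Real.pi_lt_d2, hℓ]


/-- **The `φ`-derivative of `log ‖·‖` along the arc in terms of `D`:** for `Re(½+u) > 0`,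
`½ + u ≠ 1`, `u ≠ c`, `Re(i(u−c)·S_{n,c}(u)) = −(Re(u−c)·Im D(u) + Im(u−c)·Re D(u))`
(`= −r(cos φ · Im D + sin φ · Re D)` for `u − c = r e^{iφ}`; combine with eng-2 g5's
`hasDerivAt_log_norm_arcModelIntegrand`). [folklore] -/
theorem re_I_mul_sub_mul_arcSaddleFn (n : ℕ) (c : ℂ) (hre : 0 < (1 / 2 + u).re)
    (h1 : 1 / 2 + u ≠ 1) (huc : u ≠ c) :
    (I * (u - c) * arcSaddleFn n c u).re =
      -((u - c).re * (saddleDen n c u).im + (u - c).im * (saddleDen n c u).re) := by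
  have huc' : u - c ≠ 0 := sub_ne_zero.2 huc
  rw [arcSaddleFn_eq_saddleDen_sub n c hre h1]
  have e : I * (u - c) * (saddleDen n c u - n / (u - c)) = I * ((u - c) * saddleDen n c u) - I * n := by
    field_simp
  rw [e]
  simp [Complex.mul_re, Complex.mul_im]

/-- **Descent on the upper flank:** on the right half-annulus, at a point with `Im(u−c) > 0` and
`Re(u−c) ≤ 3 ℓ_T · Im(u−c)` (angle `φ ≥ arctan(1/(3ℓ_T))`), `Re(i(u−c)S_{n,c}(u)) < 0` — the modulus
of the `ζ`-free arc integrand is strictly decreasing in `φ` there. [folklore] -/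
theorem descent_deriv_neg_of_angle_ge (hx : |x| ≤ 1 / 2) (hT : 100 ≤ T) (hℓ : 20 ≤ ell T)
    (hh : 1 / 2 ≤ bandRadius n T) (hhT : bandRadius n T ≤ 7 / 20 * T)
    (hure : 0 ≤ (u - ((x : ℂ) + (T : ℂ) * I)).re)
    (hur : ‖u - ((x : ℂ) + (T : ℂ) * I)‖ ≤ 6 / 5 * bandRadius n T)
    (hre : 0 < (1 / 2 + u).re) (h1 : 1 / 2 + u ≠ 1)
    (him : 0 < (u - ((x : ℂ) + (T : ℂ) * I)).im)
    (hangle : (u - ((x : ℂ) + (T : ℂ) * I)).re ≤ 3 * ell T * (u - ((x : ℂ) + (T : ℂ) * I)).im) :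
    (I * (u - ((x : ℂ) + (T : ℂ) * I)) * arcSaddleFn n ((x : ℂ) + (T : ℂ) * I) u).re < 0 := by
  set c : ℂ := (x : ℂ) + (T : ℂ) * I with hc
  have huc : u ≠ c := by
    intro h0; rw [h0, sub_self] at him; simp at him
  obtain ⟨hR_lo, -, hJ_lo, -⟩ := saddleDen_re_im_bounds_halfAnnulus hx hT hℓ hh hhT hure hur
  rw [re_I_mul_sub_mul_arcSaddleFn n c hre h1 huc]
  -- Re(u−c)·Im D ≥ −Re(u−c)/8 ≥ −(3ℓ/8) Im(u−c) > −(11ℓ/25) Im(u−c) ≥ −Im(u−c) Re D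
  have hA : -(1 / 8) * (u - c).re ≤ (u - c).re * (saddleDen n c u).im := by
    nlinarith [hJ_lo, hure]
  have hB : 11 / 25 * ell T * (u - c).im ≤ (u - c).im * (saddleDen n c u).re := by
    nlinarith [hR_lo, him]
  nlinarith [hA, hB, hangle, him, hℓ]

/-- **Ascent on the lower flank:** on the right half-annulus, at a point with `Im(u−c) < 0` and
`(1 + ℓ_T/9)·Re(u−c) < (11/25)ℓ_T·(−Im(u−c))` (angle `φ < −arctan((1+ℓ_T/9)/(0.44 ℓ_T))`,
`≈ −0.36` at `ℓ_T = 20`, `→ −0.25`), `Re(i(u−c)S_{n,c}(u)) > 0` — the modulus is strictly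
increasing in `φ` there. [folklore] -/
theorem ascent_deriv_pos_of_angle_le (hx : |x| ≤ 1 / 2) (hT : 100 ≤ T) (hℓ : 20 ≤ ell T)
    (hh : 1 / 2 ≤ bandRadius n T) (hhT : bandRadius n T ≤ 7 / 20 * T)
    (hure : 0 ≤ (u - ((x : ℂ) + (T : ℂ) * I)).re)
    (hur : ‖u - ((x : ℂ) + (T : ℂ) * I)‖ ≤ 6 / 5 * bandRadius n T)
    (hre : 0 < (1 / 2 + u).re) (h1 : 1 / 2 + u ≠ 1)
    (him : (u - ((x : ℂ) + (T : ℂ) * I)).im < 0)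
    (hangle : (1 + ell T / 9) * (u - ((x : ℂ) + (T : ℂ) * I)).re <
      11 / 25 * ell T * (-(u - ((x : ℂ) + (T : ℂ) * I)).im)) :
    0 < (I * (u - ((x : ℂ) + (T : ℂ) * I)) * arcSaddleFn n ((x : ℂ) + (T : ℂ) * I) u).re := by
  set c : ℂ := (x : ℂ) + (T : ℂ) * I with hc
  have huc : u ≠ c := by
    intro h0; rw [h0, sub_self] at him; simp at him
  obtain ⟨hR_lo, -, -, hJ_hi⟩ := saddleDen_re_im_bounds_halfAnnulus hx hT hℓ hh hhT hure hur
  rw [re_I_mul_sub_mul_arcSaddleFn n c hre h1 huc]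
  -- Re(u−c) Im D ≤ (1 + ℓ/9) Re(u−c) < (11ℓ/25)(−Im(u−c)) ≤ (−Im(u−c)) Re D
  have hA : (u - c).re * (saddleDen n c u).im ≤ (1 + ell T / 9) * (u - c).re := by
    nlinarith [hJ_hi, hure]
  have hB : 11 / 25 * ell T * (-(u - c).im) ≤ (-(u - c).im) * (saddleDen n c u).re := by
    nlinarith [hR_lo, him]
  nlinarith [hA, hB, hangle]

/-- **Derivative of `D` on the right half-annulus** with the bound
`‖D′(u)‖ ≤ 11.21/T + 1/(0.58T)² + (n+1)/(1.58T)²` (`λ″` from eng-2 g5's `hasDerivAt_xiGammaLogDeriv` /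
`norm_xiGammaLogDeriv2_sub_le_of_re_nonneg`; same proof as `hasDerivAt_saddleDen` on the disc). [folklore] -/
theorem hasDerivAt_saddleDen_halfAnnulus (hx : |x| ≤ 1 / 2) (hT : 100 ≤ T)
    (hh : 1 / 2 ≤ bandRadius n T) (hhT : bandRadius n T ≤ 7 / 20 * T)
    (hure : 0 ≤ (u - ((x : ℂ) + (T : ℂ) * I)).re)
    (hur : ‖u - ((x : ℂ) + (T : ℂ) * I)‖ ≤ 6 / 5 * bandRadius n T) :
    ∃ D' : ℂ, HasDerivAt (fun w : ℂ => saddleDen n ((x : ℂ) + (T : ℂ) * I) w) D' u ∧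
      ‖D'‖ ≤ 1121 / 100 / T + 1 / (29 / 50 * T) ^ 2 + ((n : ℝ) + 1) / (79 / 50 * T) ^ 2 := by
  set h := bandRadius n T with hhdef
  set c : ℂ := (x : ℂ) + (T : ℂ) * I with hc
  set s : ℂ := 1 / 2 + u with hs
  obtain ⟨him_lo, him_hi, hre_lo, hre_hi, hns_lo, hns_hi, hnu_lo, hucim, hucre, hnuc⟩ :=
    halfAnnulus_geometry hx hT hh hhT hure hur
  rw [← hc] at hucim hucre hnuc
  rw [← hs] at him_lo him_hi hre_lo hre_hi hns_lo hns_hi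
  have hT0 : 0 < T := by linarith
  have him0 : 0 < s.im := him_lo.trans_lt' (by linarith)
  have hu0 : u ≠ 0 := by
    intro h0; rw [h0, norm_zero] at hnu_lo; linarith
  have huc0 : u + c ≠ 0 := by
    intro h0; rw [h0, norm_zero] at hnuc; linarith
  -- derivative of `lamPrime` at `s`
  set L : ℂ := -1 / s ^ 2 - 1 / (s - 1) ^ 2 + deriv Complex.digamma (s / 2) / 4 with hL
  have hlam : HasDerivAt lamPrime L s := by
    unfold lamPrime; exact hasDerivAt_xiGammaLogDeriv him0
  have hlam' : HasDerivAt (fun w : ℂ => lamPrime (1 / 2 + w)) L u := by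
    have hid : HasDerivAt (fun w : ℂ => (1 / 2 : ℂ) + w) 1 u := (hasDerivAt_id u).const_add _
    have hlam2 : HasDerivAt lamPrime L ((fun w : ℂ => (1 / 2 : ℂ) + w) u) := by
      simpa only [hs] using hlam
    have hcomp : HasDerivAt (fun w : ℂ => lamPrime (1 / 2 + w)) (L * 1) u :=
      HasDerivAt.comp u hlam2 hid
    rw [mul_one] at hcomp
    exact hcomp
  have hinv : HasDerivAt (fun w : ℂ => 1 / w) (-(u ^ 2)⁻¹) u := by
    have := hasDerivAt_inv hu0
    simpa only [one_div] using this
  have hfrac : HasDerivAt (fun w : ℂ => ((n : ℂ) + 1) / (w + c)) (-(((n : ℂ) + 1) / (u + c) ^ 2)) u := by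
    have h1 : HasDerivAt (fun w : ℂ => (w + c)⁻¹) (-1 / (u + c) ^ 2) u := by
      have := ((hasDerivAt_id u).add_const c).fun_inv huc0
      simpa using this
    have h2 := h1.const_mul ((n : ℂ) + 1)
    refine h2.congr_deriv ?_ |>.congr_of_eventuallyEq ?_
    · field_simp
    · exact Filter.Eventually.of_forall fun w => by simp [div_eq_mul_inv]
  set D' : ℂ := L - (u ^ 2)⁻¹ + ((n : ℂ) + 1) / (u + c) ^ 2 with hD'
  have hDen : HasDerivAt (fun w : ℂ => saddleDen n c w) D' u := by
    have := (hlam'.add hinv).sub hfrac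
    refine this.congr_deriv ?_ |>.congr_of_eventuallyEq ?_
    · rw [hD']; ring
    · exact Filter.Eventually.of_forall fun w => by simp [saddleDen]
  refine ⟨D', hDen, ?_⟩
  -- bounds: ‖L‖ ≤ 1/(2‖s‖) + 6/Im s, ‖1/u²‖, ‖(n+1)/(u+c)²‖
  have hL2 := norm_xiGammaLogDeriv2_sub_le_of_re_nonneg (s := s) (by linarith) (by linarith)
  rw [← hL] at hL2
  have hs0 : s ≠ 0 := by intro h0; rw [h0] at him0; simp at him0
  have hLn : ‖L‖ ≤ 1 / (2 * ‖s‖) + 6 / s.im := by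
    have : ‖L‖ ≤ ‖L - 1 / (2 * s)‖ + ‖1 / (2 * s)‖ := by
      have := norm_add_le (L - 1 / (2 * s)) (1 / (2 * s)); rwa [sub_add_cancel] at this
    have e : ‖1 / (2 * s)‖ = 1 / (2 * ‖s‖) := by
      rw [norm_div, norm_one, norm_mul, Complex.norm_two]
    linarith [e]
  have hLn' : ‖L‖ ≤ 1121 / 100 / T := by
    have h1 : 1 / (2 * ‖s‖) ≤ 1 / (2 * (29 / 50 * T)) :=
      one_div_le_one_div_of_le (by positivity) (by linarith)
    have h2 : 6 / s.im ≤ 6 / (29 / 50 * T) :=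
      div_le_div_of_nonneg_left (by norm_num) (by positivity) him_lo
    have : 1 / (2 * (29 / 50 * T)) + 6 / (29 / 50 * T) ≤ 1121 / 100 / T := by
      rw [div_add_div _ _ (by positivity) (by positivity), div_le_div_iff₀ (by positivity) hT0]
      nlinarith [hT0]
    linarith
  have hu2 : ‖(u ^ 2)⁻¹‖ ≤ 1 / (29 / 50 * T) ^ 2 := by
    rw [norm_inv, norm_pow, ← one_div]
    exact one_div_le_one_div_of_le (by positivity) (pow_le_pow_left₀ (by positivity) hnu_lo 2)
  have huc2 : ‖((n : ℂ) + 1) / (u + c) ^ 2‖ ≤ ((n : ℝ) + 1) / (79 / 50 * T) ^ 2 := by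
    rw [norm_div, norm_pow]
    have hn1 : ‖(n : ℂ) + 1‖ = (n : ℝ) + 1 := by
      rw [show ((n : ℂ) + 1) = ((n + 1 : ℕ) : ℂ) by push_cast; ring, Complex.norm_natCast]; push_cast; ring
    rw [hn1]
    exact div_le_div_of_nonneg_left (by positivity) (by positivity)
      (pow_le_pow_left₀ (by positivity) hnuc 2)
  have hD'n : ‖D'‖ ≤ 1121 / 100 / T + 1 / (29 / 50 * T) ^ 2 + ((n : ℝ) + 1) / (79 / 50 * T) ^ 2 := by
    have := norm_add₃_le (a := L) (b := -(u ^ 2)⁻¹) (c := ((n : ℂ) + 1) / (u + c) ^ 2)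
    rw [norm_neg, ← sub_eq_add_neg] at this
    rw [hD']
    linarith
  exact hD'n

end halfAnnulus

end Summit.RiemannHypothesis.RiemannHypothesis.Theorems.JensenPolynomials.LogBandArc

end
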